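import Summits.ResolutionOfSingularities.ResolutionOfSingularities.Theorems.PurelyInseparableDim4E2OfCJSLocalizeProof
import Summits.ResolutionOfSingularities.ResolutionOfSingularities.Theorems.PurelyInseparableDim4E2OfCJSRowsPrime
import Summits.ResolutionOfSingularities.ResolutionOfSingularities.Theorems.PurelyInseparableDim4E2OfCJSSettingPrime
import HarnessLib
import HarnessLib.Audit.Tags

/-!
# F4-I(p,p) from CJS — row (M-b_p): the LOCALISATION of the global model at EVERY prime `p`
# (cell `res-dim4-pi`, p-program WORD #66; seat p-7 g2, holder res-dim4-p-2 g2, K res-dim4-p-9 g2)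

[OURS · counted 0 · AI work weaker than expert review.]  NOTHING here proves `NoWideTrap p p`, `NoIsolatedTrap p p`,
CJS Thm 6.40, or resolution of singularities in dimension ≥ 4 / characteristic `p`.

This is the p-generic form of `…E2OfCJSLocalizeProof` (p667552, `p = 3`): the SAME construction with `3 ↦ p`,
`HypStalk ↦ HypStalkP p`, `PresentedBy ↦ PresentedByP p` (res-dim4-p-3 g2's `…E2OfCJSRowsPrime`, p669735) and the
`hyp p` plumbing of res-dim4-p-2 g2's `…E2OfCJSSettingPrime` (p669826).

* §1 `Prime.ξ_mem_support_hypSheaf`, `Prime.mem_support_of_chart`, `Prime.exists_hypersurfaceStalkIso` — the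
  hypersurface stalk at the point over the chart's centre IS `𝒪_{𝔸⁵,0} ⧸ (z^p + F)_0` (`ker_stalkMap_subschemeι`,
  typ-3's `Equimultiple.exists_stalkIso_hypSheaf_of_zigzag`, already prime-generic).
* §2 **`Prime.localizationRow_of_strictTransform`** — the localisation row at the prime `p`, UNFOLDED (hypothesis =
  the (M-c_p) statement «controlled transform of the hypersurface = blow-up of the hypersurface at the point»,
  unfolded; conclusion = the `∃ S B π' pt b …` block of the localisation row with `PresentedByP p`): `S i =
  Spec 𝒪_{X_i, x̃ i}`, `B i = X_{i+1} ×_{X_i} S i` (blow-ups commute with the flat base change, W4.2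
  `isBlowup_pullback_snd_fromSpecStalk_singleton`), `b i` the lift of `x̃ (i+1)` (`exists_lift_pullback_fromSpecStalk`).
  The BY-NAME adapter `StrictTransformBlowupP p → LocalizationRowP p` is one line once res-dim4-p-2 g2's
  `…E2OfCJSLocalizePrime` (the two `Prop`s) lands.

bears_on: LADDER-RESOLUTION:D157-DOOR2 (res-dim4-pi · F4-I(p,p) · CJS dictionary · row M-b_p).  Supports
stmt-ResolutionOfSingularities-16155 (helper).
-/

set_option linter.dupNamespace false -- mandated namespace of this single-conjunct summit

noncomputable section

open CategoryTheory CategoryTheory.Limits AlgebraicGeometry TopologicalSpace IsLocalRing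
open Literature.AlgebraicGeometry.Resolution
open Literature.AlgebraicGeometry.Resolution.Hauser2010
open Literature.AlgebraicGeometry.Resolution.AffinePointBlowup (P A ξ)
open Literature.AlgebraicGeometry.CossartJannsenSaito2020
open Scheme.IdealSheafData
open Summit.ResolutionOfSingularities.ResolutionOfSingularities.Theorems.SigmaMaxModificationsCorridor3.Moving

namespace Summit.ResolutionOfSingularities.ResolutionOfSingularities.Theorems.PIDim4

namespace E2OfCJS

namespace Prime

open RidgeBudget (ebar)

/-! ## §1 The hypersurface stalk is presented by the chart (prime `p`) -/

section Presentation

variable {K : Type} [Field K] {p : ℕ}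

/-- **The origin of the chart lies on the hypersurface**: `ξ ∈ V((z^p + F)·𝒪)` when `ordZero F = p ≠ 0`
(the germ `z^p + F` lies in the maximal ideal). [folklore] -/
theorem ξ_mem_support_hypSheaf (hp : p ≠ 0) {F : MvPolynomial (Fin 4) K} (hF : ordZero F = (p : ℕ∞)) :
    ξ 4 K ∈ (hypSheaf p F).support := by
  rw [mem_support_iff_stalkIdeal_ne_top, stalkIdeal_hypSheaf_ξ K p]
  intro htop
  have h1 : hypGerm K p F ∈ maximalIdeal (originStalk K) :=
    hypGerm_mem_maximalIdeal K p hp F (constantCoeff_eq_zero_of_ordZero_eq hp hF)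
  have h2 : (1 : originStalk K) ∈ Ideal.span {hypGerm K p F} := by rw [htop]; exact Submodule.mem_top
  rw [Ideal.mem_span_singleton] at h2
  exact (maximalIdeal.isMaximal (originStalk K)).ne_top
    (Ideal.eq_top_of_isUnit_mem _ h1 (isUnit_of_dvd_one h2))

/-- **The marked point lies on the hypersurface**: with a chart `φ : 𝔸⁵ ⟶ Z` at `x` on which `M.ideal` reads
`(z^p + F)·𝒪` (`ordZero F = p ≠ 0`), `x ∈ V(M.ideal)`. [folklore] -/
theorem mem_support_of_chart (hp : p ≠ 0) {Z : Scheme.{0}} (M : MarkedIdeal Z) {x : Z} (φ : P 4 K ⟶ Z)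
    (hφ : φ (ξ 4 K) = x) {F : MvPolynomial (Fin 4) K} (hF : ordZero F = (p : ℕ∞))
    (hM : M.ideal.comap φ = hypSheaf p F) : x ∈ M.ideal.support := by
  have h := ξ_mem_support_hypSheaf (K := K) hp hF
  rw [← hM] at h
  have h' : ξ 4 K ∈ ((M.ideal.comap φ).support : Set (P 4 K)) := h
  rw [support_comap] at h'
  rw [← hφ]
  exact h'

/-- **PRESENTATION OF THE HYPERSURFACE STALK (prime `p`).** For `X = V(M.ideal) ⊂ Z` and a point `y` of `X` over
the chart's centre `x = φ 0` (`M.ideal.comap φ = (z^p + F)·𝒪`): `𝒪_{X, y} ≅ 𝒪_{𝔸⁵, 0} ⧸ (z^p + F)_0 = HypStalkP p K F`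
(surjective stalk map of the closed immersion with kernel `(M.ideal)_x`, `ker_stalkMap_subschemeι`; the chart
identifies `(𝒪_{Z,x}, (M.ideal)_x)` with `(𝒪_{𝔸⁵,0}, (z^p+F)_0)`, typ-3's `Equimultiple.exists_stalkIso_hypSheaf_of_zigzag`).
[cite: BierstoneGrigorievMilmanWlodarczyk2011, Lemma 8.0.3 (2)] -/
theorem exists_hypersurfaceStalkIso {Z : Scheme.{0}} (M : MarkedIdeal Z) {x : Z} (φ : P 4 K ⟶ Z)
    [IsOpenImmersion φ] (hφ : φ (ξ 4 K) = x) (s : State K) (hM : M.ideal.comap φ = hypSheaf p s.F)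
    (y : M.ideal.subscheme) (hy : M.ideal.subschemeι y = x) :
    Nonempty (M.ideal.subscheme.presheaf.stalk y ≅ HypStalkP p K s.F) := by
  -- the ambient stalk and its ideal, read on the chart
  have hM' : M.ideal.comap φ = (hypSheaf p s.F).comap (𝟙 (P 4 K)) := by rw [comap_id]; exact hM
  obtain ⟨e, he⟩ := Equimultiple.exists_stalkIso_hypSheaf_of_zigzag (p := p) φ (𝟙 (P 4 K)) (ξ 4 K) hφ rfl M s hM'
  -- the subscheme stalk is the quotient of the ambient stalk by the stalk ideal
  subst hy
  have hsurj : Function.Surjective (M.ideal.subschemeι.stalkMap y).hom :=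
    M.ideal.subschemeι.stalkMap_surjective y
  have hker : RingHom.ker (M.ideal.subschemeι.stalkMap y).hom =
      stalkIdeal M.ideal (M.ideal.subschemeι y) := ker_stalkMap_subschemeι M.ideal y
  let e₁ : (Z.presheaf.stalk (M.ideal.subschemeι y) ⧸ stalkIdeal M.ideal (M.ideal.subschemeι y)) ≃+*
      M.ideal.subscheme.presheaf.stalk y :=
    (Ideal.quotEquivOfEq hker.symm).trans (RingHom.quotientKerEquivOfSurjective hsurj)
  have hcoe : (e.commRingCatIsoToRingEquiv : Z.presheaf.stalk (M.ideal.subschemeι y) →+*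
      (P 4 K).presheaf.stalk (ξ 4 K)) = e.hom.hom := RingHom.ext fun _ => rfl
  let e₂ : (Z.presheaf.stalk (M.ideal.subschemeι y) ⧸ stalkIdeal M.ideal (M.ideal.subschemeι y)) ≃+*
      ((P 4 K).presheaf.stalk (ξ 4 K) ⧸ stalkIdeal (hypSheaf p s.F) (ξ 4 K)) :=
    Ideal.quotientEquiv _ _ e.commRingCatIsoToRingEquiv (by rw [hcoe, he])
  exact ⟨(e₁.symm.trans e₂).toCommRingCatIso⟩

end Presentation

/-! ## §2 (M-c_p) ⇒ (M-b_p): the localisation of the global model at the prime `p` -/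

section Localize

/-- **ROW (M-b_p) FROM (M-c_p), UNFOLDED: THE GLOBAL MODEL LOCALISES (every prime `p`).**  Hypothesis `hMc` = the
statement «for a marked ideal `M` of multiplicity `p` read as `(z^p + F)·𝒪` (`ordZero F = p`) on an open chart at the
closed point `x`, and a blowing up `π` of `x`, the inclusion `V((M.transform π 𝓘_x).ideal) ⟶ Z'` followed by `π`
factors through a blowing up `V(M'.ideal) ⟶ V(M.ideal)` of the (closed) point over `x`», unfolded.  Conclusion: with
`X i = V((M i).ideal)` and `x̃ i` its point over `x i`: `S i = Spec 𝒪_{X_i, x̃ i}`, `B i = X_{i+1} ×_{X_i} S i` (the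
blow-up of the closed point: blow-ups commute with the flat base change `Spec 𝒪_{X,x} ⟶ X`), `b i` the lift of
`x̃ (i+1)`, closed, with `𝒪_{B_i,b_i} ≅ 𝒪_{X_{i+1}, x̃_{i+1}}`, and every local ring presented by the frame's polynomial
at the prime `p` (`exists_hypersurfaceStalkIso`). [cite: CossartJannsenSaito2020, p. 107, Def. 6.38 / 6.39]
[cite: GortzWedhorn2020, Prop. 13.91 (2)] -/
theorem localizationRow_of_strictTransform (p : ℕ) [hpr : Fact p.Prime]
    (hMc : ∀ (K : Type) [Field K] (F : MvPolynomial (Fin 4) K) (Z Z' : Scheme.{0}) [IsLocallyNoetherian Z]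
      [IsLocallyNoetherian Z'] (M : MarkedIdeal Z) (M' : MarkedIdeal Z') (x : Z) (hx : IsClosed ({x} : Set Z))
      (φ : P 4 K ⟶ Z) [IsOpenImmersion φ] (π : Z' ⟶ Z),
      M.mult = p → ordZero F = (p : ℕ∞) → φ (ξ 4 K) = x → M.ideal.comap φ = hypSheaf p F →
      IsBlowup π (vanishingIdeal ⟨{x}, hx⟩) → M' = M.transform π (vanishingIdeal ⟨{x}, hx⟩) →
      ∃ ρ : M'.ideal.subscheme ⟶ M.ideal.subscheme,
        ρ ≫ M.ideal.subschemeι = M'.ideal.subschemeι ≫ π ∧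
        ∀ (y : M.ideal.subscheme) (hy : IsClosed ({y} : Set M.ideal.subscheme)), M.ideal.subschemeι y = x →
          IsBlowup ρ (vanishingIdeal ⟨{y}, hy⟩))
    (K : Type) [Field K] [CharP K p] [IsAlgClosed K] [DecidableEq K] (c : ℕ → State K)
    (hc : ∀ k, IsIsolated p (c k).F ∧ Step0 p (c k) (c (k + 1)) ∧ ordZero (c k).F = (p : ℕ∞) ∧ ebar (c k).F = 2)
    (Z : ℕ → Scheme.{0}) (hZ : ∀ i, IsLocallyNoetherian (Z i)) (_hJ : ∀ i, JacobsonSpace ↥(Z i))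
    (M : ∀ i, MarkedIdeal (Z i)) (x : ∀ i, ↥(Z i)) (hx : ∀ i, IsClosed ({x i} : Set (Z i)))
    (φ : ∀ i, P 4 K ⟶ Z i) (hφoi : ∀ i, IsOpenImmersion (φ i)) (π : ∀ i, Z (i + 1) ⟶ Z i)
    (hall : ∀ i, (M i).mult = p ∧ (φ i) (ξ 4 K) = x i ∧ (M i).ideal.comap (φ i) = hypSheaf p (c i).F ∧
      IsBlowup (π i) (vanishingIdeal ⟨{x i}, hx i⟩) ∧
      M (i + 1) = (M i).transform (π i) (vanishingIdeal ⟨{x i}, hx i⟩) ∧ (π i) (x (i + 1)) = x i) :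
    ∃ (S B : ℕ → Scheme.{0}) (_ : ∀ i, IsLocallyNoetherian (S i)) (_ : ∀ i, IsLocallyNoetherian (B i))
      (π' : ∀ i, B i ⟶ S i) (pt : ∀ i, ↥(S i)) (b : ∀ i, ↥(B i)) (hcl : ∀ i, IsClosed ({pt i} : Set (S i))),
      (∀ i, IsBlowup (π' i) (vanishingIdeal ⟨{pt i}, hcl i⟩)) ∧ (∀ i, (π' i).base (b i) = pt i) ∧
      (∀ i, IsClosed ({b i} : Set (B i))) ∧ (∀ i, IsLocalSchemeAt (S (i + 1)) (pt (i + 1)) (B i) (b i)) ∧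
      (∀ i, IsLocalAt (S i) (pt i)) ∧
      (∀ i, PresentedByP p K (c i).F (S i) (pt i)) ∧ (∀ i, PresentedByP p K (c (i + 1)).F (B i) (b i)) := by
  have hp : p ≠ 0 := hpr.out.ne_zero
  have hmult : ∀ i, (M i).mult = p := fun i => (hall i).1
  have hφ : ∀ i, (φ i) (ξ 4 K) = x i := fun i => (hall i).2.1
  have hMφ : ∀ i, (M i).ideal.comap (φ i) = hypSheaf p (c i).F := fun i => (hall i).2.2.1
  have hπ : ∀ i, IsBlowup (π i) (vanishingIdeal ⟨{x i}, hx i⟩) := fun i => (hall i).2.2.2.1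
  have hMsucc : ∀ i, M (i + 1) = (M i).transform (π i) (vanishingIdeal ⟨{x i}, hx i⟩) :=
    fun i => (hall i).2.2.2.2.1
  have hπx : ∀ i, (π i) (x (i + 1)) = x i := fun i => (hall i).2.2.2.2.2
  have hord : ∀ i, ordZero (c i).F = (p : ℕ∞) := fun i => (hc i).2.2.1
  -- the hypersurfaces `X i = V((M i).ideal)` and their marked (closed) points `x̃ i` over `x i`
  have hxmem : ∀ i, x i ∈ (M i).ideal.support := fun i =>
    mem_support_of_chart hp (M i) (φ i) (hφ i) (hord i) (hMφ i)
  let xt : ∀ i, ↥((M i).ideal.subscheme) := fun i => ⟨x i, hxmem i⟩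
  have hιxt : ∀ i, (M i).ideal.subschemeι (xt i) = x i := fun i => rfl
  have hxtcl : ∀ i, IsClosed ({xt i} : Set ↥((M i).ideal.subscheme)) := fun i =>
    isClosed_singleton_of_subschemeι _ _ (by rw [hιxt]; exact hx i)
  haveI hXln : ∀ i, IsLocallyNoetherian (M i).ideal.subscheme := fun i =>
    LocallyOfFiniteType.isLocallyNoetherian (M i).ideal.subschemeι
  -- (M-c_p): the restricted blow-ups `ρ i : X (i+1) ⟶ X i`
  have hρex : ∀ i, ∃ ρ : (M (i + 1)).ideal.subscheme ⟶ (M i).ideal.subscheme,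
      ρ ≫ (M i).ideal.subschemeι = (M (i + 1)).ideal.subschemeι ≫ π i ∧
        IsBlowup ρ (vanishingIdeal ⟨{xt i}, hxtcl i⟩) := by
    intro i
    haveI := hφoi i
    obtain ⟨ρ, hcomm, hbl⟩ := hMc K (c i).F (Z i) (Z (i + 1)) (M i) (M (i + 1)) (x i) (hx i) (φ i) (π i)
      (hmult i) (hord i) (hφ i) (hMφ i) (hπ i) (hMsucc i)
    exact ⟨ρ, hcomm, hbl (xt i) (hxtcl i) (hιxt i)⟩
  choose ρ hρcomm hρbl using hρex
  have hρxt : ∀ i, (ρ i).base (xt (i + 1)) = xt i := by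
    intro i
    apply (M i).ideal.subschemeι.isEmbedding.injective
    have h := congrArg (fun f => f.base (xt (i + 1))) (hρcomm i)
    simp only [Scheme.Hom.comp_base, TopCat.coe_comp, Function.comp_apply] at h
    exact h.trans (hπx i)
  -- the local schemes `S i = Spec 𝒪_{X_i, x̃ i}`
  have hc0 : ∀ i, (((M i).ideal.subscheme).fromSpecStalk (xt i)).base
      (closedPoint (((M i).ideal.subscheme).presheaf.stalk (xt i))) = xt i :=
    fun i => Scheme.fromSpecStalk_closedPoint
  have hptcl : ∀ i, IsClosed ({closedPoint (((M i).ideal.subscheme).presheaf.stalk (xt i))} :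
      Set ↥(Spec (((M i).ideal.subscheme).presheaf.stalk (xt i)))) :=
    fun i => isClosed_singleton_of_fromSpecStalk_eq (hc0 i)
  -- the base changes `B i`
  haveI hBln : ∀ i, IsLocallyNoetherian
      (pullback (ρ i) (((M i).ideal.subscheme).fromSpecStalk (xt i))) :=
    fun i => isLocallyNoetherian_pullback_fromSpecStalk (hρbl i) (xt i)
  have hrad : ∀ i, vanishingIdeal (⟨{xt i}, hxtcl i⟩ : Closeds ↥((M i).ideal.subscheme)) =
      vanishingIdeal (vanishingIdeal (⟨{xt i}, hxtcl i⟩ : Closeds ↥((M i).ideal.subscheme))).support := by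
    intro i
    rw [show (vanishingIdeal (⟨{xt i}, hxtcl i⟩ : Closeds ↥((M i).ideal.subscheme))).support =
      (⟨{xt i}, hxtcl i⟩ : Closeds ↥((M i).ideal.subscheme)) from
        SetLike.coe_injective (Scheme.IdealSheafData.coe_support_vanishingIdeal _)]
  have hmax : ∀ i, stalkIdeal (vanishingIdeal (⟨{xt i}, hxtcl i⟩ : Closeds ↥((M i).ideal.subscheme))) (xt i) =
      maximalIdeal _ := fun i => stalkIdeal_vanishingIdeal_singleton (hxtcl i)
  have hbl' : ∀ i, IsBlowup (pullback.snd (ρ i) (((M i).ideal.subscheme).fromSpecStalk (xt i)))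
      (vanishingIdeal ⟨{closedPoint (((M i).ideal.subscheme).presheaf.stalk (xt i))}, hptcl i⟩) :=
    fun i => isBlowup_pullback_snd_fromSpecStalk_singleton (hρbl i) (hrad i) (hmax i) (hc0 i)
  -- the lifts `b i` of `x̃ (i+1)`
  have hlift : ∀ i, ∃ b : ↥(pullback (ρ i) (((M i).ideal.subscheme).fromSpecStalk (xt i))),
      (pullback.fst (ρ i) (((M i).ideal.subscheme).fromSpecStalk (xt i))).base b = xt (i + 1) ∧
        (((M i).ideal.subscheme).fromSpecStalk (xt i)).base
            ((pullback.snd (ρ i) (((M i).ideal.subscheme).fromSpecStalk (xt i))).base b) = xt i ∧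
          IsIso ((pullback.fst (ρ i) (((M i).ideal.subscheme).fromSpecStalk (xt i))).stalkMap b) :=
    fun i => exists_lift_pullback_fromSpecStalk (ρ i) (xt i) (hρxt i)
  choose b hb hbs hbiso using hlift
  -- the stalk isomorphisms `𝒪_{B_i, b_i} ≅ 𝒪_{X_{i+1}, x̃_{i+1}}`
  have hstalk : ∀ i, Nonempty ((pullback (ρ i) (((M i).ideal.subscheme).fromSpecStalk (xt i))).presheaf.stalk
      (b i) ≅ ((M (i + 1)).ideal.subscheme).presheaf.stalk (xt (i + 1))) := by
    intro i
    haveI := hbiso i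
    exact ⟨(asIso ((pullback.fst (ρ i) (((M i).ideal.subscheme).fromSpecStalk (xt i))).stalkMap (b i))).symm ≪≫
      eqToIso (by rw [hb i])⟩
  -- the presentations of the hypersurface stalks at the prime `p`
  have hpres : ∀ i, Nonempty (((M i).ideal.subscheme).presheaf.stalk (xt i) ≅ HypStalkP p K (c i).F) := by
    intro i
    haveI := hφoi i
    exact exists_hypersurfaceStalkIso (M i) (φ i) (hφ i) (c i) (hMφ i) (xt i) (hιxt i)
  refine ⟨fun i => Spec (((M i).ideal.subscheme).presheaf.stalk (xt i)),
    fun i => pullback (ρ i) (((M i).ideal.subscheme).fromSpecStalk (xt i)), fun i => inferInstance, hBln,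
    fun i => pullback.snd (ρ i) (((M i).ideal.subscheme).fromSpecStalk (xt i)),
    fun i => closedPoint (((M i).ideal.subscheme).presheaf.stalk (xt i)), b, hptcl, hbl', ?_, ?_, ?_, ?_, ?_, ?_⟩
  · -- `π' i (b i) = pt i`
    exact fun i => eq_closedPoint_of_fromSpecStalk_eq (hbs i)
  · -- `b i` is closed: a specialization of `b i` lies over the closed point and over `x̃ (i+1)`
    intro i
    have hcl : closure ({b i} : Set ↥(pullback (ρ i) (((M i).ideal.subscheme).fromSpecStalk (xt i)))) ⊆
        {b i} := by
      intro b' hb'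
      have hbb' : b i ⤳ b' := specializes_iff_mem_closure.mpr hb'
      have h1 : xt (i + 1) ⤳ (pullback.fst (ρ i) (((M i).ideal.subscheme).fromSpecStalk (xt i))).base b' :=
        hb i ▸ hbb'.map (pullback.fst (ρ i) (((M i).ideal.subscheme).fromSpecStalk (xt i))).continuous
      have h2 : (pullback.fst (ρ i) (((M i).ideal.subscheme).fromSpecStalk (xt i))).base b' = xt (i + 1) :=
        Set.mem_singleton_iff.mp (h1.mem_closed (hxtcl (i + 1)) rfl)
      have hinj : Function.Injective
          (pullback.fst (ρ i) (((M i).ideal.subscheme).fromSpecStalk (xt i))).base :=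
        (pullback.fst (ρ i) (((M i).ideal.subscheme).fromSpecStalk (xt i))).isEmbedding.injective
      exact Set.mem_singleton_iff.mpr (hinj (h2.trans (hb i).symm))
    exact isClosed_of_closure_subset hcl
  · -- `S (i+1)` is the local scheme of `B i` at `b i`
    intro i
    obtain ⟨e⟩ := hstalk i
    exact isLocalSchemeAt_Spec_of_iso e
  · -- `S i` is local at its closed point
    exact fun i => isLocalAt_Spec_closedPoint _
  · -- `S i` presented by `(c i).F`
    intro i
    obtain ⟨e⟩ := hpres i
    exact ⟨stalkClosedPointIso (((M i).ideal.subscheme).presheaf.stalk (xt i)) ≪≫ e⟩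
  · -- `B i` presented by `(c (i+1)).F`
    intro i
    obtain ⟨e₁⟩ := hstalk i
    obtain ⟨e₂⟩ := hpres (i + 1)
    exact ⟨e₁ ≪≫ e₂⟩

end Localize

end Prime

end E2OfCJS

end Summit.ResolutionOfSingularities.ResolutionOfSingularities.Theorems.PIDim4

end
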